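import Summits.Ventures.PercRepro.Night2SeriesClassFour
import Summits.Ventures.PercRepro.Night2TriangleDisjoint
import Summits.Ventures.PercRepro.Night2SeriesTriangleCellsB

/-!
# PercRepro — **THE `(7, 5)` CELL `(3, 0)` AT `|G| = 12` CLOSES OUTRIGHT**, `|G| = 11` with `≤ 4` fat thin closures;
residues P (night-2, gen 23)

Beyond a triangle of 2-cocircuits `{p, x}, {p, y}, {x, y}` (series transitivity), a further fat thin member's missed
pair `Q` is either disjoint from the triangle (the triangle-plus-disjoint count, `Night2TriangleDisjoint`) or meets
it in exactly one point — then `{p, x, y, z}` is a `K₄` of 2-cocircuits (transitivity twice,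
`sixCocircuits_of_triangle_and_pair`) and the `K₄` count applies (`Night2SeriesClassFour`).  Count sums at `(3, 0)`:
`K₄`: `1529793/1345960 = 1.137` at `n = 11`, `9945121/7873866 = 1.263` at `n = 12` (chord); triangle + disjoint:
`150138675/141395996 = 1.062` at `n = 11` (face-sum budget, `k = 4`), `17842745/16266796 = 1.097` at `n = 12` (chord).
With the earlier cells: **`localShadowHall_three_zero_six_twelve`** (every `G` with a fat thin member) and
**`localShadowHall_three_zero_six_eleven_of_le_four`**; **`shadowHall_seven_five_of_residuesP`**: the `(3, 0)`
residue is the single cell `|G| = 11` with `NoFourDisjointFat` and at least FIVE fat thin closures.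
-/

namespace PercRepro.Shadow

open Finset PerFlat ThmH

/-- The count sum of the cell `(3, 0)` at `n = 11` with the count `cntK4` and `E = 8 / 27`: `1.137 ≥ 1`. -/
theorem countSum_three_zero_eleven_K4 :
    1 ≤ countSum 11 6 3 (cPrimeDGP 5 3 6 0 2) (8 / 27 : ℚ) (cntK4 6) := by
  rw [cPrimeDGP_three_zero_two]
  unfold countSum DGenP.cjG cntK4
  rw [show Finset.Icc 1 (11 - 6) = {1, 2, 3, 4, 5} by decide]
  repeat rw [Finset.sum_insert (by decide)]
  rw [Finset.sum_singleton]
  norm_num [Nat.choose_eq_descFactorial_div_factorial, Nat.descFactorial, Nat.factorial]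

/-- The count sum of the cell `(3, 0)` at `n = 12` with the count `cntK4` and `E = 13 / 50`: `1.263 ≥ 1`. -/
theorem countSum_three_zero_twelve_K4 :
    1 ≤ countSum 12 6 3 (cPrimeDGP 5 3 6 0 2) (13 / 50 : ℚ) (cntK4 6) := by
  rw [cPrimeDGP_three_zero_two]
  unfold countSum DGenP.cjG cntK4
  rw [show Finset.Icc 1 (12 - 6) = {1, 2, 3, 4, 5, 6} by decide]
  repeat rw [Finset.sum_insert (by decide)]
  rw [Finset.sum_singleton]
  norm_num [Nat.choose_eq_descFactorial_div_factorial, Nat.descFactorial, Nat.factorial]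

/-- The count sum of the cell `(3, 0)` at `n = 11` with the count `cntTriD` and `E = 113 / 405`: `1.062 ≥ 1`. -/
theorem countSum_three_zero_eleven_triD_b4 :
    1 ≤ countSum 11 6 3 (cPrimeDGP 5 3 6 0 2) (113 / 405 : ℚ) (cntTriD 6) := by
  rw [cPrimeDGP_three_zero_two]
  unfold countSum DGenP.cjG cntTriD
  rw [show Finset.Icc 1 (11 - 6) = {1, 2, 3, 4, 5} by decide]
  repeat rw [Finset.sum_insert (by decide)]
  rw [Finset.sum_singleton]
  norm_num [Nat.choose_eq_descFactorial_div_factorial, Nat.descFactorial, Nat.factorial]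

/-- The count sum of the cell `(3, 0)` at `n = 12` with the count `cntTriD` and `E = 13 / 50`: `1.097 ≥ 1`. -/
theorem countSum_three_zero_twelve_triD :
    1 ≤ countSum 12 6 3 (cPrimeDGP 5 3 6 0 2) (13 / 50 : ℚ) (cntTriD 6) := by
  rw [cPrimeDGP_three_zero_two]
  unfold countSum DGenP.cjG cntTriD
  rw [show Finset.Icc 1 (12 - 6) = {1, 2, 3, 4, 5, 6} by decide]
  repeat rw [Finset.sum_insert (by decide)]
  rw [Finset.sum_singleton]
  norm_num [Nat.choose_eq_descFactorial_div_factorial, Nat.descFactorial, Nat.factorial]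

/-- `fatBudgetFS 5 3 6 4 11 (2/9) (1/54) = 113/405`. -/
theorem fatBudgetFS_three_zero_eleven_four : fatBudgetFS 5 3 6 4 11 (2 / 9 : ℚ) (1 / 54 : ℚ) = (113 / 405 : ℚ) := by
  unfold fatBudgetFS capDG phiQ; norm_num

variable {α : Type*} [DecidableEq α] {M : Matroid α} [M.Finite]

/-- **The six cocircuits of a `K₄` class**: on a coloop-free flat, the triangle `{p, x}, {p, y}` (hence `{x, y}`) and a
pair `{a, z}` with `a ∈ {p, x, y}`, `z ∉ {p, x, y}` make every pair of `{p, x, y, z}` a 2-cocircuit. -/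
theorem sixCocircuits_of_triangle_and_pair {q : ℕ} {G : Finset α} (hG : G ∈ flatsQ M (q + 1))
    (hk0 : kColoops M G = 0) {p x y z a : α} (hpx : p ≠ x) (hpy : p ≠ y) (hxy : x ≠ y)
    (hpG : p ∈ G) (hxG : x ∈ G) (hyG : y ∈ G) (hzG : z ∈ G)
    (hH₀ : M.eRk ((G \ {p, x} : Finset α) : Set α) ≤ (q : ℕ∞))
    (hH₁ : M.eRk ((G \ {p, y} : Finset α) : Set α) ≤ (q : ℕ∞))
    (ha : a = p ∨ a = x ∨ a = y) (hz : z ≠ p ∧ z ≠ x ∧ z ≠ y)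
    (hHa : M.eRk ((G \ {a, z} : Finset α) : Set α) ≤ (q : ℕ∞)) :
    ∀ u ∈ ({p, x, y, z} : Finset α), ∀ v ∈ ({p, x, y, z} : Finset α), u ≠ v →
      M.eRk ((G \ {u, v} : Finset α) : Set α) ≤ (q : ℕ∞) := by
  obtain ⟨hzp, hzx, hzy⟩ := hz
  have hsd : ∀ {u v : α}, u ∈ G → v ∈ G → G \ (G \ {u, v}) = {u, v} := fun hu hv =>
    Finset.sdiff_sdiff_eq_self (Finset.insert_subset hu (Finset.singleton_subset_iff.2 hv))
  -- the transitivity step in the form «shared point first»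
  have tr : ∀ {u v w : α}, u ∈ G → v ∈ G → w ∈ G → u ≠ v → u ≠ w → v ≠ w →
      M.eRk ((G \ {u, v} : Finset α) : Set α) ≤ (q : ℕ∞) → M.eRk ((G \ {u, w} : Finset α) : Set α) ≤ (q : ℕ∞) →
      M.eRk ((G \ {v, w} : Finset α) : Set α) ≤ (q : ℕ∞) := by
    intro u v w hu hv hw huv huw hvw h1 h2
    exact eRk_sdiff_pair_le_of_series hG hk0 h1 h2 (hsd hu hv) (hsd hu hw) huv huw hvw
  have comm : ∀ {u v : α}, M.eRk ((G \ {u, v} : Finset α) : Set α) ≤ (q : ℕ∞) →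
      M.eRk ((G \ {v, u} : Finset α) : Set α) ≤ (q : ℕ∞) := by
    intro u v h; rwa [Finset.pair_comm]
  have hH₂ : M.eRk ((G \ {x, y} : Finset α) : Set α) ≤ (q : ℕ∞) := tr hpG hxG hyG hpx hpy hxy hH₀ hH₁
  -- the three pairs through `z`
  have hpz : M.eRk ((G \ {p, z} : Finset α) : Set α) ≤ (q : ℕ∞) ∧
      M.eRk ((G \ {x, z} : Finset α) : Set α) ≤ (q : ℕ∞) ∧ M.eRk ((G \ {y, z} : Finset α) : Set α) ≤ (q : ℕ∞) := by
    rcases ha with rfl | rfl | rfl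
    · exact ⟨hHa, tr hpG hxG hzG hpx hzp.symm hzx.symm hH₀ hHa, tr hpG hyG hzG hpy hzp.symm hzy.symm hH₁ hHa⟩
    · exact ⟨tr hxG hpG hzG hpx.symm hzx.symm hzp.symm (comm hH₀) hHa, hHa,
        tr hxG hyG hzG hxy hzx.symm hzy.symm hH₂ hHa⟩
    · exact ⟨tr hyG hpG hzG hpy.symm hzy.symm hzp.symm (comm hH₁) hHa,
        tr hyG hxG hzG hxy.symm hzy.symm hzx.symm (comm hH₂) hHa, hHa⟩
  obtain ⟨hpz', hxz', hyz'⟩ := hpz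
  intro u hu v hv huv
  simp only [Finset.mem_insert, Finset.mem_singleton] at hu hv
  rcases hu with rfl | rfl | rfl | rfl <;> rcases hv with rfl | rfl | rfl | rfl <;>
    first
    | exact absurd rfl huv
    | exact hH₀ | exact hH₁ | exact hpz' | exact hH₂ | exact hxz' | exact hyz'
    | exact comm hH₀ | exact comm hH₁ | exact comm hpz' | exact comm hH₂ | exact comm hxz' | exact comm hyz'

open scoped Classical in
/-- **The cell `(3, 0)` at `|G| = 11` with a `K₄` series class** `{p, x, y, z}` (the six pairs are 2-cocircuits):
(LI_G) through the `K₄` count and `E = 8 / 27`. -/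
theorem localShadowHall_three_zero_six_eleven_of_K4 {G : Finset α} (hG : G ∈ flatsQ M (5 + 1))
    (hd : (gr M \ G).card = 3) (hk : kColoops M G = 0)
    (hs : ∀ e ∈ gr M, ∀ f ∈ gr M, e ≠ f → rkN M {e, f} = 2) (hl : ∀ e ∈ gr M, M.Indep {e})
    (hn : G.card = 11) {p x y z : α} (hpx : p ≠ x) (hpy : p ≠ y) (hpz : p ≠ z) (hxy : x ≠ y) (hxz : x ≠ z)
    (hyz : y ≠ z)
    (hcoc : ∀ a ∈ ({p, x, y, z} : Finset α), ∀ b ∈ ({p, x, y, z} : Finset α), a ≠ b →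
      M.eRk ((G \ {a, b} : Finset α) : Set α) ≤ ((5 : ℕ) : ℕ∞)) :
    LocalShadowHall M 5 G := by
  have hk' : kColoops M G + 6 = 5 + 1 := by omega
  have hd' : (gr M \ G).card ≤ 5 := by omega
  have hm2 : ∀ B ∈ thinMembers M 5 G, 6 ≤ (B \ coloops M G).card → 2 ≤ (G \ clF M B).card :=
    fun B hB _ => two_le_card_sdiff_of_not_lay0 hG hd' (mem_thinMembers.1 hB).1 (mem_thinMembers.1 hB).2
  have hc2 : 0 ≤ cPrimeDGP 5 3 6 (kColoops M G) 2 := by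
    rw [hk]; unfold cPrimeDGP capDG reqDGP phiQ; norm_num
  have hn' : G.card - kColoops M G = 11 := by omega
  have hKG : coloops M G ⊆ G := fun y hy => (mem_coloops.1 hy).1
  have hnK : (G \ coloops M G).card = 11 := by
    rw [Finset.card_sdiff_of_subset hKG, ← kColoops_eq_card_coloops]; omega
  have hKempty : coloops M G = ∅ := by
    rw [kColoops_eq_card_coloops] at hk
    exact Finset.card_eq_zero.1 hk
  refine localShadowHall_excess_of_count (d := 3) (ρ := 6) (m₁ := 2) hG hd (by norm_num) hk' (by norm_num)
    hs hl hc2 hm2 (E := (8 / 27 : ℚ)) (by norm_num) ?_ (cnt := cntK4 6) ?_ ?_ ?_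
  · intro S _ T hT
    have hT' : T ∈ (S \ coloops M G).powersetCard 6 := by
      unfold coverBases at hT
      exact (Finset.mem_filter.1 hT).1
    have h := sum_faceLoss_union_le (a := (11 / 45 : ℚ)) (b := (1 / 45 : ℚ)) hG hd (by norm_num) hk' (by omega)
      hs hl (by norm_num) (by rw [hnK]; intro m h1 h2; exact DGenP.chord_three_zero_11 m h1 (by omega))
      (by rw [hnK, hk, DGenP.excessBound_three_zero_11]; norm_num) hT'
    rw [hnK, hk, DGenP.excessBound_three_zero_11] at h
    exact h
  · intro s h1 h2
    rw [hn'] at h2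
    exact cntK4_six_pos s h1 (by omega)
  · intro S hSG
    refine card_coverBases_le_cntK4 hk' (by norm_num) hpx hpy hpz hxy hxz hyz ?_ hSG
    intro a ha b hb hab
    exact ⟨by rw [hKempty]; exact Finset.empty_subset _, hcoc a ha b hb hab⟩
  · rw [hn', hk]
    exact countSum_three_zero_eleven_K4

open scoped Classical in
/-- **The cell `(3, 0)` at `|G| = 12` with a `K₄` series class** `{p, x, y, z}` (the six pairs are 2-cocircuits):
(LI_G) through the `K₄` count and `E = 13 / 50`. -/
theorem localShadowHall_three_zero_six_twelve_of_K4 {G : Finset α} (hG : G ∈ flatsQ M (5 + 1))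
    (hd : (gr M \ G).card = 3) (hk : kColoops M G = 0)
    (hs : ∀ e ∈ gr M, ∀ f ∈ gr M, e ≠ f → rkN M {e, f} = 2) (hl : ∀ e ∈ gr M, M.Indep {e})
    (hn : G.card = 12) {p x y z : α} (hpx : p ≠ x) (hpy : p ≠ y) (hpz : p ≠ z) (hxy : x ≠ y) (hxz : x ≠ z)
    (hyz : y ≠ z)
    (hcoc : ∀ a ∈ ({p, x, y, z} : Finset α), ∀ b ∈ ({p, x, y, z} : Finset α), a ≠ b →
      M.eRk ((G \ {a, b} : Finset α) : Set α) ≤ ((5 : ℕ) : ℕ∞)) :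
    LocalShadowHall M 5 G := by
  have hk' : kColoops M G + 6 = 5 + 1 := by omega
  have hd' : (gr M \ G).card ≤ 5 := by omega
  have hm2 : ∀ B ∈ thinMembers M 5 G, 6 ≤ (B \ coloops M G).card → 2 ≤ (G \ clF M B).card :=
    fun B hB _ => two_le_card_sdiff_of_not_lay0 hG hd' (mem_thinMembers.1 hB).1 (mem_thinMembers.1 hB).2
  have hc2 : 0 ≤ cPrimeDGP 5 3 6 (kColoops M G) 2 := by
    rw [hk]; unfold cPrimeDGP capDG reqDGP phiQ; norm_num
  have hn' : G.card - kColoops M G = 12 := by omega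
  have hKG : coloops M G ⊆ G := fun y hy => (mem_coloops.1 hy).1
  have hnK : (G \ coloops M G).card = 12 := by
    rw [Finset.card_sdiff_of_subset hKG, ← kColoops_eq_card_coloops]; omega
  have hKempty : coloops M G = ∅ := by
    rw [kColoops_eq_card_coloops] at hk
    exact Finset.card_eq_zero.1 hk
  refine localShadowHall_excess_of_count (d := 3) (ρ := 6) (m₁ := 2) hG hd (by norm_num) hk' (by norm_num)
    hs hl hc2 hm2 (E := (13 / 50 : ℚ)) (by norm_num) ?_ (cnt := cntK4 6) ?_ ?_ ?_
  · intro S _ T hT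
    have hT' : T ∈ (S \ coloops M G).powersetCard 6 := by
      unfold coverBases at hT
      exact (Finset.mem_filter.1 hT).1
    have h := sum_faceLoss_union_le (a := (6 / 25 : ℚ)) (b := (1 / 50 : ℚ)) hG hd (by norm_num) hk' (by omega)
      hs hl (by norm_num) (by rw [hnK]; intro m h1 h2; exact DGenP.chord_three_zero_12 m h1 (by omega))
      (by rw [hnK, hk, DGenP.excessBound_three_zero_12]; norm_num) hT'
    rw [hnK, hk, DGenP.excessBound_three_zero_12] at h
    exact h
  · intro s h1 h2
    rw [hn'] at h2
    exact cntK4_six_pos s h1 (by omega)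
  · intro S hSG
    refine card_coverBases_le_cntK4 hk' (by norm_num) hpx hpy hpz hxy hxz hyz ?_ hSG
    intro a ha b hb hab
    exact ⟨by rw [hKempty]; exact Finset.empty_subset _, hcoc a ha b hb hab⟩
  · rw [hn', hk]
    exact countSum_three_zero_twelve_K4

open scoped Classical in
/-- **The cell `(3, 0)` at `|G| = 11` with a triangle `{p, x}, {p, y}, {x, y}` of 2-cocircuits and a fat thin member
missing a pair disjoint from it**: (LI_G) through the triangle-plus-disjoint count and `E = 113 / 405`. -/
theorem localShadowHall_three_zero_six_eleven_of_triD {G : Finset α} (hG : G ∈ flatsQ M (5 + 1))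
    (hd : (gr M \ G).card = 3) (hk : kColoops M G = 0)
    (hs : ∀ e ∈ gr M, ∀ f ∈ gr M, e ≠ f → rkN M {e, f} = 2) (hl : ∀ e ∈ gr M, M.Indep {e})
    (hn : G.card = 11) {p x y : α} (hpx : p ≠ x) (hpy : p ≠ y) (hxy : x ≠ y)
    (hH₀ : M.eRk ((G \ {p, x} : Finset α) : Set α) ≤ ((5 : ℕ) : ℕ∞))
    (hH₁ : M.eRk ((G \ {p, y} : Finset α) : Set α) ≤ ((5 : ℕ) : ℕ∞))
    (hH₂ : M.eRk ((G \ {x, y} : Finset α) : Set α) ≤ ((5 : ℕ) : ℕ∞))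
    (hpG : p ∈ G) (hxG : x ∈ G) (hyG : y ∈ G)
    {B₃ : Finset α} (hB₃ : B₃ ∈ thinMembers M 5 G) (hfat₃ : (G \ clF M B₃).card ≤ 2)
    (hd₃ : (G \ clF M B₃) ∩ {p, x, y} = ∅)
    (hcl : (fatClosures M 5 G 2).card ≤ 4) :
    LocalShadowHall M 5 G := by
  have hk' : kColoops M G + 6 = 5 + 1 := by omega
  have hd' : (gr M \ G).card ≤ 5 := by omega
  have hm2 : ∀ B ∈ thinMembers M 5 G, 6 ≤ (B \ coloops M G).card → 2 ≤ (G \ clF M B).card :=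
    fun B hB _ => two_le_card_sdiff_of_not_lay0 hG hd' (mem_thinMembers.1 hB).1 (mem_thinMembers.1 hB).2
  have hc2 : 0 ≤ cPrimeDGP 5 3 6 (kColoops M G) 2 := by
    rw [hk]; unfold cPrimeDGP capDG reqDGP phiQ; norm_num
  have hn' : G.card - kColoops M G = 11 := by omega
  have hKG : coloops M G ⊆ G := fun y hy => (mem_coloops.1 hy).1
  have hnK : (G \ coloops M G).card = 11 := by
    rw [Finset.card_sdiff_of_subset hKG, ← kColoops_eq_card_coloops]; omega
  have hKempty : coloops M G = ∅ := by
    rw [kColoops_eq_card_coloops] at hk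
    exact Finset.card_eq_zero.1 hk
  have hP₀ : G \ (G \ {p, x}) = {p, x} :=
    Finset.sdiff_sdiff_eq_self (Finset.insert_subset hpG (Finset.singleton_subset_iff.2 hxG))
  have hP₁ : G \ (G \ {p, y}) = {p, y} :=
    Finset.sdiff_sdiff_eq_self (Finset.insert_subset hpG (Finset.singleton_subset_iff.2 hyG))
  have hP₂ : G \ (G \ {x, y}) = {x, y} :=
    Finset.sdiff_sdiff_eq_self (Finset.insert_subset hxG (Finset.singleton_subset_iff.2 hyG))
  have hKe : ∀ {H : Finset α}, coloops M G ⊆ H := by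
    intro H; rw [hKempty]; exact Finset.empty_subset _
  refine localShadowHall_excess_of_count (d := 3) (ρ := 6) (m₁ := 2) hG hd (by norm_num) hk' (by norm_num)
    hs hl hc2 hm2 (E := (113 / 405 : ℚ)) (by norm_num) ?_ (cnt := cntTriD 6) ?_ ?_ ?_
  · intro S _ T hT
    have hT' : T ∈ (S \ coloops M G).powersetCard 6 := by
      unfold coverBases at hT
      exact (Finset.mem_filter.1 hT).1
    have h := sum_faceLoss_budgetFS_union_le (k := 4) (a := (2 / 9 : ℚ)) (b := (1 / 54 : ℚ)) hG hd
      (by norm_num) hk' hk (by norm_num) hs hl (by norm_num) (by rw [hnK]; norm_num)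
      (by rw [hnK]; intro m h1 h2; exact chord3_three_zero_11 m h1 (by omega)) (by norm_num)
      (by rw [hnK, fatBudgetFS_three_zero_eleven_four]; norm_num) hcl hT'
    rw [hnK, fatBudgetFS_three_zero_eleven_four] at h
    exact h
  · intro s h1 h2
    rw [hn'] at h2
    exact cntTriD_six_pos s h1 (by omega)
  · intro S hSG
    exact card_coverBases_le_cntTriD hk' (by norm_num) hKe hH₀ hKe hH₁ hKe hH₂
      (coloops_subset_clF_of_mem_thinMembers hG hd' hB₃) (eRk_clF_le_of_mem_thinMembers hB₃) hP₀ hP₁ hP₂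
      hpx hpy hxy hfat₃ hd₃ hSG
  · rw [hn', hk]
    exact countSum_three_zero_eleven_triD_b4

open scoped Classical in
/-- **The cell `(3, 0)` at `|G| = 12` with a triangle `{p, x}, {p, y}, {x, y}` of 2-cocircuits and a fat thin member
missing a pair disjoint from it**: (LI_G) through the triangle-plus-disjoint count and `E = 13 / 50`. -/
theorem localShadowHall_three_zero_six_twelve_of_triD {G : Finset α} (hG : G ∈ flatsQ M (5 + 1))
    (hd : (gr M \ G).card = 3) (hk : kColoops M G = 0)
    (hs : ∀ e ∈ gr M, ∀ f ∈ gr M, e ≠ f → rkN M {e, f} = 2) (hl : ∀ e ∈ gr M, M.Indep {e})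
    (hn : G.card = 12) {p x y : α} (hpx : p ≠ x) (hpy : p ≠ y) (hxy : x ≠ y)
    (hH₀ : M.eRk ((G \ {p, x} : Finset α) : Set α) ≤ ((5 : ℕ) : ℕ∞))
    (hH₁ : M.eRk ((G \ {p, y} : Finset α) : Set α) ≤ ((5 : ℕ) : ℕ∞))
    (hH₂ : M.eRk ((G \ {x, y} : Finset α) : Set α) ≤ ((5 : ℕ) : ℕ∞))
    (hpG : p ∈ G) (hxG : x ∈ G) (hyG : y ∈ G)
    {B₃ : Finset α} (hB₃ : B₃ ∈ thinMembers M 5 G) (hfat₃ : (G \ clF M B₃).card ≤ 2)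
    (hd₃ : (G \ clF M B₃) ∩ {p, x, y} = ∅) :
    LocalShadowHall M 5 G := by
  have hk' : kColoops M G + 6 = 5 + 1 := by omega
  have hd' : (gr M \ G).card ≤ 5 := by omega
  have hm2 : ∀ B ∈ thinMembers M 5 G, 6 ≤ (B \ coloops M G).card → 2 ≤ (G \ clF M B).card :=
    fun B hB _ => two_le_card_sdiff_of_not_lay0 hG hd' (mem_thinMembers.1 hB).1 (mem_thinMembers.1 hB).2
  have hc2 : 0 ≤ cPrimeDGP 5 3 6 (kColoops M G) 2 := by
    rw [hk]; unfold cPrimeDGP capDG reqDGP phiQ; norm_num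
  have hn' : G.card - kColoops M G = 12 := by omega
  have hKG : coloops M G ⊆ G := fun y hy => (mem_coloops.1 hy).1
  have hnK : (G \ coloops M G).card = 12 := by
    rw [Finset.card_sdiff_of_subset hKG, ← kColoops_eq_card_coloops]; omega
  have hKempty : coloops M G = ∅ := by
    rw [kColoops_eq_card_coloops] at hk
    exact Finset.card_eq_zero.1 hk
  have hP₀ : G \ (G \ {p, x}) = {p, x} :=
    Finset.sdiff_sdiff_eq_self (Finset.insert_subset hpG (Finset.singleton_subset_iff.2 hxG))
  have hP₁ : G \ (G \ {p, y}) = {p, y} :=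
    Finset.sdiff_sdiff_eq_self (Finset.insert_subset hpG (Finset.singleton_subset_iff.2 hyG))
  have hP₂ : G \ (G \ {x, y}) = {x, y} :=
    Finset.sdiff_sdiff_eq_self (Finset.insert_subset hxG (Finset.singleton_subset_iff.2 hyG))
  have hKe : ∀ {H : Finset α}, coloops M G ⊆ H := by
    intro H; rw [hKempty]; exact Finset.empty_subset _
  refine localShadowHall_excess_of_count (d := 3) (ρ := 6) (m₁ := 2) hG hd (by norm_num) hk' (by norm_num)
    hs hl hc2 hm2 (E := (13 / 50 : ℚ)) (by norm_num) ?_ (cnt := cntTriD 6) ?_ ?_ ?_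
  · intro S _ T hT
    have hT' : T ∈ (S \ coloops M G).powersetCard 6 := by
      unfold coverBases at hT
      exact (Finset.mem_filter.1 hT).1
    have h := sum_faceLoss_union_le (a := (6 / 25 : ℚ)) (b := (1 / 50 : ℚ)) hG hd (by norm_num) hk' (by omega)
      hs hl (by norm_num) (by rw [hnK]; intro m h1 h2; exact DGenP.chord_three_zero_12 m h1 (by omega))
      (by rw [hnK, hk, DGenP.excessBound_three_zero_12]; norm_num) hT'
    rw [hnK, hk, DGenP.excessBound_three_zero_12] at h
    exact h
  · intro s h1 h2
    rw [hn'] at h2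
    exact cntTriD_six_pos s h1 (by omega)
  · intro S hSG
    exact card_coverBases_le_cntTriD hk' (by norm_num) hKe hH₀ hKe hH₁ hKe hH₂
      (coloops_subset_clF_of_mem_thinMembers hG hd' hB₃) (eRk_clF_le_of_mem_thinMembers hB₃) hP₀ hP₁ hP₂
      hpx hpy hxy hfat₃ hd₃ hSG
  · rw [hn', hk]
    exact countSum_three_zero_twelve_triD

end PercRepro.Shadow
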